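import Literature.NumberTheory.Weil1965.AdelicSiegelFunctionalComplex
import HarnessLib

/-!
# `Σ_ξ F*_Φ(ξ) = Σ_b ∫ Φ dμ_b` for complex `Φ ∈ 𝒮(X)` once `E_X` is tempered

Topic `NumberTheory/Weil1965`; namespace `Literature.NumberTheory.Weil1965` (sequel of `AdelicFibreMeasures`,
`AdelicSiegelFunctionalComplex`).  KERNEL MATHEMATICS ONLY: proved theorems, no definition, no named fact, no `sorry`.

[Weil1965, Chap. IV n° 41, (34)–(35) pp. 58–59]: the functional `E_X(Φ) = Σ_{ξ ∈ F} F*_Φ(ξ)` on `𝒮(X)`, `X = 𝔸_F^ι`, "est une mesure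
positive tempérée", and `E_X = Σ_{b ∈ F} μ_b` with `μ_b` carried by `h⁻¹(b)`.  In the tree `E_X` is the positive functional
`adelicSiegelFunctional` on REAL Schwartz–Bruhat functions, `ν₀ = adelicSiegelMeasure` its Radon measure with `∫ Ψ dν₀ ≤ E_X(Ψ)`, and
`μ_b = adelicSiegelFibreMeasure … b`; EQUALITY `∫ Ψ dν₀ = E_X(Ψ)` for every `Ψ ∈ 𝒮_ℝ(X)` — TEMPEREDNESS — is Weil's "convergence
uniforme sur toute partie compacte de `𝒮(X)`" (supplied from the family-uniform condition (B) by `AdelicFibreMeasuresCutoff`).  This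
file is the formal step from temperedness to the consumers' identity on COMPLEX test functions:

* `integrable_adelicSiegelMeasure_of_tempered` — every `Φ ∈ 𝒮(X)` is `ν₀`-integrable;
* `tsum_adelicSiegelCoeff_eq_integral_of_tempered` — `Σ_ξ F*_Φ(ξ) = ∫ Φ dν₀`;
* `tsum_adelicSiegelCoeff_eq_tsum_integral_fibre_of_tempered` — `Σ_ξ F*_Φ(ξ) = Σ'_{b ∈ F} ∫ Φ dμ_b`, and
  `hasSum_integral_adelicSiegelFibreMeasure_of_tempered` — `HasSum (b ↦ ∫ Φ dμ_b) (Σ_ξ F*_Φ(ξ))`.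
-/

set_option autoImplicit false

noncomputable section

open MeasureTheory NumberField Literature.NumberTheory.Automorphic
open scoped Classical

namespace Literature.NumberTheory.Weil1965

variable (F : Type) [Field F] [NumberField F] (ι : Type) [Fintype ι]
  [MeasurableSpace (adeleQuotient F)] [BorelSpace (adeleQuotient F)]
  [MeasurableSpace (AdeleRing (𝓞 F) F)] [BorelSpace (AdeleRing (𝓞 F) F)]
  {μ : Measure (ι → AdeleRing (𝓞 F) F)} [μ.IsAddHaarMeasure]
  {h : (ι → AdeleRing (𝓞 F) F) → AdeleRing (𝓞 F) F} (hh : Continuous h)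
  (hB : ∀ Φ ∈ piSchwartzBruhat F ι, Summable fun ξ : F => ‖adelicSiegelCoeff F ι μ h Φ ξ‖)
  (htemp : ∀ Ψ : piSchwartzBruhatReal F ι,
    Integrable (Ψ : (ι → AdeleRing (𝓞 F) F) → ℝ) (adelicSiegelMeasure F ι μ h hh hB) ∧
      ∫ x, (Ψ : (ι → AdeleRing (𝓞 F) F) → ℝ) x ∂(adelicSiegelMeasure F ι μ h hh hB) =
        adelicSiegelFunctional F ι μ h hh hB Ψ)

include htemp in
/-- **every `Φ ∈ 𝒮(X)` is `ν₀`-integrable** when `E_X` is tempered (its real and imaginary parts are).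
[cite: Weil1965, Chap. IV n° 41, (35) p. 59] -/
theorem integrable_adelicSiegelMeasure_of_tempered {Φ : (ι → AdeleRing (𝓞 F) F) → ℂ} (hΦ : Φ ∈ piSchwartzBruhat F ι) :
    Integrable Φ (adelicSiegelMeasure F ι μ h hh hB) :=
  Integrable.re_im_iff.1
    ⟨(htemp ⟨fun v => (Φ v).re, re_mem_piSchwartzBruhatReal hΦ⟩).1,
      (htemp ⟨fun v => (Φ v).im, im_mem_piSchwartzBruhatReal hΦ⟩).1⟩

include htemp in
/-- **`Σ_ξ F*_Φ(ξ) = ∫ Φ dν₀`** for `Φ ∈ 𝒮(X)` when `E_X` is tempered: `Σ_ξ F*_Φ = E_X(Re Φ) + i E_X(Im Φ)`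
(`tsum_adelicSiegelCoeff_eq_re_add_im`) `= ∫ Re Φ dν₀ + i ∫ Im Φ dν₀ = ∫ Φ dν₀`. [cite: Weil1965, Chap. IV n° 41, (34)–(35) p. 59] -/
theorem tsum_adelicSiegelCoeff_eq_integral_of_tempered {Φ : (ι → AdeleRing (𝓞 F) F) → ℂ} (hΦ : Φ ∈ piSchwartzBruhat F ι) :
    ∑' ξ : F, adelicSiegelCoeff F ι μ h Φ ξ = ∫ x, Φ x ∂(adelicSiegelMeasure F ι μ h hh hB) := by
  rw [tsum_adelicSiegelCoeff_eq_re_add_im F ι hh hB hΦ,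
    ← (htemp ⟨fun v => (Φ v).re, re_mem_piSchwartzBruhatReal hΦ⟩).2,
    ← (htemp ⟨fun v => (Φ v).im, im_mem_piSchwartzBruhatReal hΦ⟩).2,
    ← integral_re_add_im (integrable_adelicSiegelMeasure_of_tempered F ι hh hB htemp hΦ), mul_comm]
  rfl

include htemp in
/-- **`Σ_ξ F*_Φ(ξ) = Σ'_{b ∈ F} ∫ Φ dμ_b`** for `Φ ∈ 𝒮(X)` when `E_X` is tempered (`ν₀ = Σ_b μ_b`).
[cite: Weil1965, Chap. IV n° 41, (35) p. 59] -/
theorem tsum_adelicSiegelCoeff_eq_tsum_integral_fibre_of_tempered {Φ : (ι → AdeleRing (𝓞 F) F) → ℂ}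
    (hΦ : Φ ∈ piSchwartzBruhat F ι) :
    ∑' ξ : F, adelicSiegelCoeff F ι μ h Φ ξ =
      ∑' b : F, ∫ x, Φ x ∂(adelicSiegelFibreMeasure F ι μ h hh hB b) := by
  rw [tsum_adelicSiegelCoeff_eq_integral_of_tempered F ι hh hB htemp hΦ]
  exact integral_adelicSiegelMeasure_eq_tsum hh hB (integrable_adelicSiegelMeasure_of_tempered F ι hh hB htemp hΦ)

include htemp in
/-- **`HasSum (b ↦ ∫ Φ dμ_b) (Σ_ξ F*_Φ(ξ))`** for `Φ ∈ 𝒮(X)` when `E_X` is tempered. [cite: Weil1965, Chap. IV n° 41, (35) p. 59] -/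
theorem hasSum_integral_adelicSiegelFibreMeasure_of_tempered {Φ : (ι → AdeleRing (𝓞 F) F) → ℂ}
    (hΦ : Φ ∈ piSchwartzBruhat F ι) :
    HasSum (fun b : F => ∫ x, Φ x ∂(adelicSiegelFibreMeasure F ι μ h hh hB b))
      (∑' ξ : F, adelicSiegelCoeff F ι μ h Φ ξ) := by
  rw [tsum_adelicSiegelCoeff_eq_integral_of_tempered F ι hh hB htemp hΦ, ← sum_adelicSiegelFibreMeasure]
  refine hasSum_integral_measure ?_
  rw [sum_adelicSiegelFibreMeasure]
  exact integrable_adelicSiegelMeasure_of_tempered F ι hh hB htemp hΦ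

end Literature.NumberTheory.Weil1965

end
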